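import Summits.Langlands.Langlands.Theses.PicardMuOrdinary
import Summits.Langlands.Langlands.Theorems.PicardMuOrdinaryIrregularClassicalityEssPolarized
import HarnessLib

/-!
# RE-ROUTE KIT (untwisted essentially-polarized currency) for route `PicardMuOrdinary` — crux workfile of
# stmt-Langlands-13758, line `slope-free-polarized-limit` r14 (lead c16, 2026-08-17)

For the tenure planner's restate of the 13757→13758 interface.  Kernel-checked against the current route decls and the
LANDED glue `Theorems/PicardMuOrdinaryIrregularClassicalityEssPolarized.lean` (p162865, p163193):

* `closes_essPolarized : ResidualAutomorphyOdd → ResidualAutomorphyEven → 13757♮ → 13758♮ → SectorComplement → Langlands`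
  with 13757♮ = `MuOrdinaryFamilyRTEssPolarized` SPELLED OUT (the residual-automorphy hypothesis of `MuOrdinaryFamilyRT`
  verbatim ⇒ the conclusion of the registered W♮ `stub_essPolarizationDebt`: an essentially `c₀`-polarized regular
  algebraic cuspidal avatar tower with `ι`-adic bounds for the UNTWISTED traces `e(a_𝔭(f))`, `S ⊇ {v ∣ 3}`) and 13758♮ = C3♮
  (`IrregularClassicalityEssPolarized`, spelled out; = children3.json item 2; closed by H♮ + F1 via the landed
  `irregularClassicalityEssPolarized_of_essHeart`).  Under this restate the wall W♮ is the identity and is never filed;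
  no ψ-twist, no `LimitTwist`, no primary generators anywhere in the route.
* `muOrdinaryFamilyRTEssPolarized_of_wall : MuOrdinaryFamilyRT → W♮ → 13757♮` — the restate asks nothing of the family
  theorem beyond the wall.

(Not landed under Theorems/: the spelled-out signatures exceed the 4000-char sub-goal registration limit; this workfile is
the certificate, as `Lines/split_ramified_prime_sqrt6_route_ord.lean` was for the ordinary restate.)
-/

open Literature.NumberTheory.GaloisRepresentations Literature.NumberTheory.Automorphic
open Literature.NumberTheory
open scoped NumberField
open IsDedekindDomain NumberField Polynomial Filter Field

set_option linter.dupNamespace false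
set_option autoImplicit false

namespace Summit.Langlands.Langlands.Cruxes.IrregularClassicality.SlopeFreePolarizedLimit.RouteEss

open scoped Classical in
/-- **The re-routed deciding theorem (untwisted essentially-polarized currency)** — for the tenure planner's restate:
`ResidualAutomorphyOdd → ResidualAutomorphyEven → MuOrdinaryFamilyRTEssPolarized → IrregularClassicalityEssPolarized →
SectorComplement → Langlands`, where 13757♮ `MuOrdinaryFamilyRTEssPolarized` (spelled out: the residual-automorphy hypothesis of
`MuOrdinaryFamilyRT` VERBATIM ⇒ the conclusion of W♮ = an essentially `c₀`-polarized regular algebraic cuspidal avatar tower with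
`ι`-adic bounds for the UNTWISTED traces `e(a_𝔭(f))`, `S ⊇ {v ∣ 3}`) and 13758♮ = C3♮ (spelled out) replace 13757/13758.  Under it
the wall W♮ is the identity and is never filed; the glue is the route's own `closes` script.  The analogue of
`closes_polarized` (p141145) with no ψ-twist, no `LimitTwist`, no primary generators. -/
theorem closes_essPolarized : Summit.Langlands.Langlands.Theses.PicardMuOrdinary.ResidualAutomorphyOdd → Summit.Langlands.Langlands.Theses.PicardMuOrdinary.ResidualAutomorphyEven → (∀ (f : Polynomial ℤ) (hcpt : Literature.NumberTheory.Automorphic.isCompact_glFiniteIntegralLevel 3 (CyclotomicField 3 ℚ)), f.natDegree = 4 → (f.map (Int.castRingHom ℚ)).Separable → 12 ∣ Nat.card (f.map (Int.castRingHom ℚ)).Gal → (∃ (P : Literature.NumberTheory.Automorphic.CuspidalAutomorphicRepData 3 (CyclotomicField 3 ℚ) hcpt) (𝔐 : Ideal (integralClosure ℤ ℂ)), P.1.IsRegularAlgebraic ∧ 𝔐.IsMaximal ∧ (3 : (integralClosure ℤ ℂ)) ∈ 𝔐 ∧ ∀ᶠ 𝔭 : IsDedekindDomain.HeightOneSpectrum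 (NumberField.RingOfIntegers (CyclotomicField 3 ℚ)) in Filter.cofinite, ∃ (α : Multiset ℂ) (Q : Polynomial (integralClosure ℤ ℂ)), P.1.HasSatakeParamAt 𝔭 α ∧ Q.map (algebraMap (integralClosure ℤ ℂ) ℂ) = (α.map (fun a => Polynomial.X - Polynomial.C ((𝔭.residueCard : ℂ) * a))).prod ∧ Q.map (Ideal.Quotient.mk 𝔐) = (if (f.map ((Ideal.Quotient.mk 𝔭.asIdeal).comp (algebraMap ℤ (NumberField.RingOfIntegers (CyclotomicField 3 ℚ))))).roots.toFinset.card = 4 then (Polynomial.X - 1) ^ 3 else if (f.map ((Ideal.Quotient.mk 𝔭.asIdeal).comp (algebraMap ℤ (NumberField.RingOfIntegers (CyclotomicField 3 ℚ))))).roots.toFinset.card = 2 then (Polynomial.X - 1) ^ 2 * (Polynomial.X + 1) else if (f.map ((Ideal.Quotient.mk 𝔭.asIdeal).comp (algebraMap ℤ (NumberField.RingOfIntegers (CyclotomicField 3 ℚ))))).roots.toFinset.card = 1 then Polynomial.X ^ 3 - 1 else if (∃ y : ((NumberField.RingOfIntegers (CyclotomicField 3 ℚ)) ⧸ 𝔭.asIdeal),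 y ^ 2 = (f.map ((Ideal.Quotient.mk 𝔭.asIdeal).comp (algebraMap ℤ (NumberField.RingOfIntegers (CyclotomicField 3 ℚ))))).discr) then (Polynomial.X - 1) * (Polynomial.X + 1) ^ 2 else Polynomial.X ^ 3 + Polynomial.X ^ 2 + Polynomial.X + 1 : Polynomial ℤ).map (Int.castRingHom ((integralClosure ℤ ℂ) ⧸ 𝔐))) → ∃ (e : (CyclotomicField 3 ℚ) →+* ℂ) (ι : PadicAlgCl 3 ≃+* ℂ) (S : Finset (IsDedekindDomain.HeightOneSpectrum (NumberField.RingOfIntegers (CyclotomicField 3 ℚ)))) (c₀ : (CyclotomicField 3 ℚ) ≃ₐ[ℚ] (CyclotomicField 3 ℚ)), c₀ ≠ 1 ∧ (∀ v : IsDedekindDomain.HeightOneSpectrum (NumberField.RingOfIntegers (CyclotomicField 3 ℚ)), ((3 : ℕ) : NumberField.RingOfIntegers (CyclotomicField 3 ℚ)) ∈ v.asIdeal → v ∈ S) ∧ ∀ k : ℕ, ∃ (P : Literature.NumberTheory.Automorphic.CuspidalAutomorphicRepData 3 (CyclotomicField 3 ℚ) hcpt) (r : Literature.NumberTheory.GaloisRepresentations.FramedGaloisRep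 (CyclotomicField 3 ℚ) (PadicAlgCl 3) 3) (χ : Literature.NumberTheory.GaloisRepresentations.HeckeCharacter (CyclotomicField 3 ℚ)), P.1.IsRegularAlgebraic ∧ P.1.IsGalConjEssSelfDual c₀ χ ∧ ∀ 𝔭 ∉ S, P.1.IsUnramifiedAt 𝔭 ∧ Literature.NumberTheory.Automorphic.IsGaloisCompatibleAt P.1 ι r 𝔭 ∧ ∃ (α : Multiset ℂ) (t : (integralClosure ℤ ℂ)), P.1.HasSatakeParamAt 𝔭 α ∧ (t : ℂ) = (𝔭.residueCard : ℂ) * α.sum - e (Literature.NumberTheory.GaloisRepresentations.picardTrace f 𝔭) ∧ ‖ι.symm (t : ℂ)‖ ≤ ((3 : ℝ)⁻¹) ^ k) → (∀ (f : Polynomial ℤ) (hcpt : Literature.NumberTheory.Automorphic.isCompact_glFiniteIntegralLevel 3 (CyclotomicField 3 ℚ)), f.natDegree = 4 → (f.map (Int.castRingHom ℚ)).Separable → 12 ∣ Nat.card (f.map (Int.castRingHom ℚ)).Gal → (∃ (e : (CyclotomicField 3 ℚ) →+* ℂ) (ι : PadicAlgCl 3 ≃+* ℂ) (S : Finset (IsDedekindDomain.HeightOneSpectrum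 (NumberField.RingOfIntegers (CyclotomicField 3 ℚ)))) (c₀ : (CyclotomicField 3 ℚ) ≃ₐ[ℚ] (CyclotomicField 3 ℚ)), c₀ ≠ 1 ∧ (∀ v : IsDedekindDomain.HeightOneSpectrum (NumberField.RingOfIntegers (CyclotomicField 3 ℚ)), ((3 : ℕ) : NumberField.RingOfIntegers (CyclotomicField 3 ℚ)) ∈ v.asIdeal → v ∈ S) ∧ ∀ k : ℕ, ∃ (P : Literature.NumberTheory.Automorphic.CuspidalAutomorphicRepData 3 (CyclotomicField 3 ℚ) hcpt) (r : Literature.NumberTheory.GaloisRepresentations.FramedGaloisRep (CyclotomicField 3 ℚ) (PadicAlgCl 3) 3) (χ : Literature.NumberTheory.GaloisRepresentations.HeckeCharacter (CyclotomicField 3 ℚ)), P.1.IsRegularAlgebraic ∧ P.1.IsGalConjEssSelfDual c₀ χ ∧ ∀ 𝔭 ∉ S, P.1.IsUnramifiedAt 𝔭 ∧ Literature.NumberTheory.Automorphic.IsGaloisCompatibleAt P.1 ι r 𝔭 ∧ ∃ (α : Multiset ℂ) (t : (integralClosure ℤ ℂ)), P.1.HasSatakeParamAt 𝔭 α ∧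 (t : ℂ) = (𝔭.residueCard : ℂ) * α.sum - e (Literature.NumberTheory.GaloisRepresentations.picardTrace f 𝔭) ∧ ‖ι.symm (t : ℂ)‖ ≤ ((3 : ℝ)⁻¹) ^ k) → ∃ (e : (CyclotomicField 3 ℚ) →+* ℂ) (π : Literature.NumberTheory.Automorphic.CuspidalAutomorphicRepData 3 (CyclotomicField 3 ℚ) hcpt), π.1.IsLAlgebraic ∧ ∀ᶠ 𝔭 : IsDedekindDomain.HeightOneSpectrum (NumberField.RingOfIntegers (CyclotomicField 3 ℚ)) in Filter.cofinite, ∃ α : Multiset ℂ, π.1.HasSatakeParamAt 𝔭 α ∧ α.sum = e (Literature.NumberTheory.GaloisRepresentations.picardTrace f 𝔭)) → Summit.Langlands.Langlands.Theses.PicardMuOrdinary.SectorComplement → _root_.Langlands := by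
  intro hOdd hEven hRT hCl hC
  refine hC ?_
  intro f hcpt hdeg hsep hgal
  refine hCl f hcpt hdeg hsep hgal (hRT f hcpt hdeg hsep hgal ?_)
  by_cases h4 : (f.map (Int.castRingHom ℝ)).roots.card = 4
  · exact hEven f hcpt hdeg hsep hgal h4
  · exact hOdd f hcpt hdeg hsep hgal h4

open scoped Classical in
/-- **13757♮ follows from 13757 and W♮** (so the re-route asks nothing new of the family theorem beyond the wall):
`MuOrdinaryFamilyRT → W♮ → MuOrdinaryFamilyRTEssPolarized` (spelled out). -/
theorem muOrdinaryFamilyRTEssPolarized_of_wall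
    (hRT : Summit.Langlands.Langlands.Theses.PicardMuOrdinary.MuOrdinaryFamilyRT)
    (hW : ∀ (f : Polynomial ℤ) (hcpt : Literature.NumberTheory.Automorphic.isCompact_glFiniteIntegralLevel 3 (CyclotomicField 3 ℚ)), f.natDegree = 4 → (f.map (Int.castRingHom ℚ)).Separable → 12 ∣ Nat.card (f.map (Int.castRingHom ℚ)).Gal → (∃ (e : CyclotomicField 3 ℚ →+* ℂ) (𝔐 : Ideal (integralClosure ℤ ℂ)) (S : Finset (IsDedekindDomain.HeightOneSpectrum (NumberField.RingOfIntegers (CyclotomicField 3 ℚ)))), 𝔐.IsMaximal ∧ (3 : (integralClosure ℤ ℂ)) ∈ 𝔐 ∧ ∀ k : ℕ, ∃ P : Literature.NumberTheory.Automorphic.CuspidalAutomorphicRepData 3 (CyclotomicField 3 ℚ) hcpt, P.1.IsRegularAlgebraic ∧ ∀ 𝔭 ∉ S, ∃ (α : Multiset ℂ) (t u : (integralClosure ℤ ℂ)), P.1.HasSatakeParamAt 𝔭 α ∧ (t : ℂ) = (𝔭.residueCard : ℂ) * α.sum - e (Literature.NumberTheory.GaloisRepresentations.picardTrace f 𝔭)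 ∧ u ∉ 𝔐 ∧ u * t ∈ Ideal.span {(3 : (integralClosure ℤ ℂ)) ^ k}) → ∃ (e : (CyclotomicField 3 ℚ) →+* ℂ) (ι : PadicAlgCl 3 ≃+* ℂ) (S : Finset (IsDedekindDomain.HeightOneSpectrum (NumberField.RingOfIntegers (CyclotomicField 3 ℚ)))) (c₀ : (CyclotomicField 3 ℚ) ≃ₐ[ℚ] (CyclotomicField 3 ℚ)), c₀ ≠ 1 ∧ (∀ v : IsDedekindDomain.HeightOneSpectrum (NumberField.RingOfIntegers (CyclotomicField 3 ℚ)), ((3 : ℕ) : NumberField.RingOfIntegers (CyclotomicField 3 ℚ)) ∈ v.asIdeal → v ∈ S) ∧ ∀ k : ℕ, ∃ (P : Literature.NumberTheory.Automorphic.CuspidalAutomorphicRepData 3 (CyclotomicField 3 ℚ) hcpt) (r : Literature.NumberTheory.GaloisRepresentations.FramedGaloisRep (CyclotomicField 3 ℚ) (PadicAlgCl 3) 3) (χ : Literature.NumberTheory.GaloisRepresentations.HeckeCharacter (CyclotomicField 3 ℚ)), P.1.IsRegularAlgebraic ∧ P.1.IsGalConjEssSelfDual c₀ χ ∧ ∀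 𝔭 ∉ S, P.1.IsUnramifiedAt 𝔭 ∧ Literature.NumberTheory.Automorphic.IsGaloisCompatibleAt P.1 ι r 𝔭 ∧ ∃ (α : Multiset ℂ) (t : (integralClosure ℤ ℂ)), P.1.HasSatakeParamAt 𝔭 α ∧ (t : ℂ) = (𝔭.residueCard : ℂ) * α.sum - e (Literature.NumberTheory.GaloisRepresentations.picardTrace f 𝔭) ∧ ‖ι.symm (t : ℂ)‖ ≤ ((3 : ℝ)⁻¹) ^ k) :
    ∀ (f : Polynomial ℤ) (hcpt : Literature.NumberTheory.Automorphic.isCompact_glFiniteIntegralLevel 3 (CyclotomicField 3 ℚ)), f.natDegree = 4 → (f.map (Int.castRingHom ℚ)).Separable → 12 ∣ Nat.card (f.map (Int.castRingHom ℚ)).Gal → (∃ (P : Literature.NumberTheory.Automorphic.CuspidalAutomorphicRepData 3 (CyclotomicField 3 ℚ) hcpt) (𝔐 : Ideal (integralClosure ℤ ℂ)), P.1.IsRegularAlgebraic ∧ 𝔐.IsMaximal ∧ (3 : (integralClosure ℤ ℂ)) ∈ 𝔐 ∧ ∀ᶠ 𝔭 : IsDedekindDomain.HeightOneSpectrum (NumberField.RingOfIntegers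 (CyclotomicField 3 ℚ)) in Filter.cofinite, ∃ (α : Multiset ℂ) (Q : Polynomial (integralClosure ℤ ℂ)), P.1.HasSatakeParamAt 𝔭 α ∧ Q.map (algebraMap (integralClosure ℤ ℂ) ℂ) = (α.map (fun a => Polynomial.X - Polynomial.C ((𝔭.residueCard : ℂ) * a))).prod ∧ Q.map (Ideal.Quotient.mk 𝔐) = (if (f.map ((Ideal.Quotient.mk 𝔭.asIdeal).comp (algebraMap ℤ (NumberField.RingOfIntegers (CyclotomicField 3 ℚ))))).roots.toFinset.card = 4 then (Polynomial.X - 1) ^ 3 else if (f.map ((Ideal.Quotient.mk 𝔭.asIdeal).comp (algebraMap ℤ (NumberField.RingOfIntegers (CyclotomicField 3 ℚ))))).roots.toFinset.card = 2 then (Polynomial.X - 1) ^ 2 * (Polynomial.X + 1) else if (f.map ((Ideal.Quotient.mk 𝔭.asIdeal).comp (algebraMap ℤ (NumberField.RingOfIntegers (CyclotomicField 3 ℚ))))).roots.toFinset.card = 1 then Polynomial.X ^ 3 - 1 else if (∃ y : ((NumberField.RingOfIntegers (CyclotomicField 3 ℚ)) ⧸ 𝔭.asIdeal), y ^ 2 =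 (f.map ((Ideal.Quotient.mk 𝔭.asIdeal).comp (algebraMap ℤ (NumberField.RingOfIntegers (CyclotomicField 3 ℚ))))).discr) then (Polynomial.X - 1) * (Polynomial.X + 1) ^ 2 else Polynomial.X ^ 3 + Polynomial.X ^ 2 + Polynomial.X + 1 : Polynomial ℤ).map (Int.castRingHom ((integralClosure ℤ ℂ) ⧸ 𝔐))) → ∃ (e : (CyclotomicField 3 ℚ) →+* ℂ) (ι : PadicAlgCl 3 ≃+* ℂ) (S : Finset (IsDedekindDomain.HeightOneSpectrum (NumberField.RingOfIntegers (CyclotomicField 3 ℚ)))) (c₀ : (CyclotomicField 3 ℚ) ≃ₐ[ℚ] (CyclotomicField 3 ℚ)), c₀ ≠ 1 ∧ (∀ v : IsDedekindDomain.HeightOneSpectrum (NumberField.RingOfIntegers (CyclotomicField 3 ℚ)), ((3 : ℕ) : NumberField.RingOfIntegers (CyclotomicField 3 ℚ)) ∈ v.asIdeal → v ∈ S) ∧ ∀ k : ℕ, ∃ (P : Literature.NumberTheory.Automorphic.CuspidalAutomorphicRepData 3 (CyclotomicField 3 ℚ) hcpt) (r : Literature.NumberTheory.GaloisRepresentations.FramedGaloisRep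 (CyclotomicField 3 ℚ) (PadicAlgCl 3) 3) (χ : Literature.NumberTheory.GaloisRepresentations.HeckeCharacter (CyclotomicField 3 ℚ)), P.1.IsRegularAlgebraic ∧ P.1.IsGalConjEssSelfDual c₀ χ ∧ ∀ 𝔭 ∉ S, P.1.IsUnramifiedAt 𝔭 ∧ Literature.NumberTheory.Automorphic.IsGaloisCompatibleAt P.1 ι r 𝔭 ∧ ∃ (α : Multiset ℂ) (t : (integralClosure ℤ ℂ)), P.1.HasSatakeParamAt 𝔭 α ∧ (t : ℂ) = (𝔭.residueCard : ℂ) * α.sum - e (Literature.NumberTheory.GaloisRepresentations.picardTrace f 𝔭) ∧ ‖ι.symm (t : ℂ)‖ ≤ ((3 : ℝ)⁻¹) ^ k :=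
  fun f hcpt hdeg hsep hgal hres => hW f hcpt hdeg hsep hgal (hRT f hcpt hdeg hsep hgal hres)

end Summit.Langlands.Langlands.Cruxes.IrregularClassicality.SlopeFreePolarizedLimit.RouteEss
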